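import Summits.AtomisticToContinuum.Crystallization.Theorems.PricedLinkCensusLocalToGlobalThomsonDefs
import Literature.Analysis.FluidPDE.WholeSpaceIBP
import Literature.Analysis.FluidPDE.NewtonKernel
import Literature.Analysis.FunctionSpaces.SmoothParametricIntegral

/-!
# The transverse escape flux: calculus of the radial 5-D field `Q(z) · (0, z″)`

Route `PricedLinkCensus`, crux `LocalToGlobal` (stmt-AtomisticToContinuum-14232), line
`flux-cell-joint-census`, support for the registered stub `stub_confinedThomson : ConfinedThomson`
(non-emptiness of the admissible confined fluxes).  A unit charge smeared on the 8-ball `B(ι x, ε)` can be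
drained to transverse infinity INSIDE the tube `B(x, ε) × ℝ⁵`: on each fibre `{z′} × ℝ⁵` solve
`div_{z″} (Q z″) = density` radially.  For a profile `g : ℝ → ℝ` (think `g = 𝟙_{[0, ε²)}` or a smooth
approximation of it) put, with `A = ‖z′ - x‖²`, `T = ‖z″‖²` (`z′ = proj z`, `(0, z″) = perp z`),

  `Q_g(z) = ∫₀¹ w⁴ g(A + T w²) dw`  (`escapeCoeff`),  `H_g(z) = Q_g(z) · perp z`  (`escapeField`).

For smooth `g` the field `H_g` is `C¹` and (Euler-type identity for the radial ODE `5Q + 2T ∂_T Q = g(A+T)`)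

  `div H_g (z) = 5 Q_g(z) + DQ_g(z)[perp z] = g(‖z - ι x‖²)`  (`divergence_escapeField`):

`DQ_g(z)[perp z] = ∫₀¹ w⁴ g′(A + Tw²) · 2Tw² dw` (differentiation under the integral sign, the directions
`DA(z)[perp z] = 0`, `DT(z)[perp z] = 2T`), and `∫₀¹ (w⁵ g(A + Tw²))′ dw = g(A + T)`.  Hence the weak form
`∫ ⟪H_g, ∇φ⟫ = -∫ g(‖z - ι x‖²) φ` for `φ ∈ C¹_c` (`integral_inner_escapeField`).  Also: the pointwise bounds
`0 ≤ Q_g ≤ 1/5`, `Q_g(z) ≤ ε⁴/T²`, the support `Q_g(z) = 0` unless `‖z′ - x‖ < ε` (for `0 ≤ g ≤ 𝟙_{(-∞, ε²)}`),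
and the weighted bound `‖H_g(z)‖ ≤ ε(1+ε)³ (1 + ‖perp z‖)⁻³`.

Also here (from the splitting `ℝ⁸ = ℝ³ × ℝ⁵` of `PricedLinkCensusLocalToGlobalThomsonDefs`): `div perp = 5`
(`tr(id - emb proj) = 8 - 3`), `measurePreserving_splitMap` (linear isometries preserve volume,
`WithLp.volume_preserving_ofLp`) and the slab majorant `𝟙[proj z ∈ B(x,ε)] (1 + ‖perp z‖)⁻ʳ ∈ L¹(ℝ⁸)`, `r > 5`.

References: folklore (method of characteristics for `div (q(r) y) = ρ` in `ℝ⁵`: `q = m(r)/(|S⁴| r⁵)`);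
L. C. Evans, *PDE* (2010), App. C.2 (Gauss–Green), §2.2.1 (radial solutions).
-/

noncomputable section

open MeasureTheory Set Filter Metric Topology InnerProductSpace Function intervalIntegral
open scoped RealInnerProductSpace ContDiff

namespace Summit.AtomisticToContinuum.Crystallization.Theorems.PricedLinkCensusLocalToGlobal

variable {g : ℝ → ℝ} {x : E3} {ε : ℝ}

/-! ### The splitting `ℝ⁸ = ℝ³ × ℝ⁵`: transverse trace, product measure, slab majorant -/

/-- `tr (emb ∘ proj) = tr (proj ∘ emb) = tr id_{ℝ³} = 3`. [folklore] -/
theorem trace_embL_comp_projL : LinearMap.trace ℝ E8 ((embL.comp projL : E8 →L[ℝ] E8) : E8 →ₗ[ℝ] E8) = 3 := by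
  have h1 : ((embL.comp projL : E8 →L[ℝ] E8) : E8 →ₗ[ℝ] E8) = (embL : E3 →ₗ[ℝ] E8) ∘ₗ (projL : E8 →ₗ[ℝ] E3) := rfl
  have h2 : (projL : E8 →ₗ[ℝ] E3) ∘ₗ (embL : E3 →ₗ[ℝ] E8) = LinearMap.id := by
    ext a i
    simp [proj_emb]
  rw [h1, LinearMap.trace_comp_comm', h2, LinearMap.trace_id, finrank_euclideanSpace_fin]
  norm_num

/-- **`div perp = 5`** at every point (the derivative of the linear map `perp` is `perp`, whose trace is
`tr id_{ℝ⁸} - tr (emb proj) = 8 - 3`). [folklore] -/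
theorem divergence_perpL (z : E8) : Literature.Analysis.FluidPDE.VectorCalculus.divergence perpL z = 5 := by
  rw [Literature.Analysis.FluidPDE.VectorCalculus.divergence, perpL.fderiv]
  rw [show ((perpL : E8 →L[ℝ] E8) : E8 →ₗ[ℝ] E8) =
      LinearMap.id - ((embL.comp projL : E8 →L[ℝ] E8) : E8 →ₗ[ℝ] E8) from rfl,
    map_sub, LinearMap.trace_id, trace_embL_comp_projL, finrank_euclideanSpace_fin]
  norm_num

/-- **The splitting preserves Lebesgue measure**: `vol₈ = (vol₃ ⊗ vol₅) ∘ split`. [folklore] -/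
theorem measurePreserving_splitMap : MeasurePreserving splitMap (volume : Measure E8) (volume : Measure (E3 × E5)) :=
  (splitIso.measurePreserving).trans (WithLp.volume_preserving_ofLp E3 E5)

/-- **The slab majorant is integrable**: `z ↦ 𝟙[proj z ∈ B(x,ε)] K (1 + ‖perp z‖)⁻ʳ ∈ L¹(ℝ⁸)` for `r > 5`
(product of the indicator of a 3-ball and of `(1 + ‖b‖)⁻ʳ ∈ L¹(ℝ⁵)`). [folklore] -/
theorem integrable_slab_weight (x : E3) (ε K : ℝ) {r : ℝ} (hr : 5 < r) :
    Integrable fun z : E8 => (ball x ε).indicator (fun _ => K) (proj z) * (1 + ‖perpL z‖) ^ (-r) := by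
  have hf : Integrable (fun a : E3 => (ball x ε).indicator (fun _ => K) a) :=
    (integrable_indicator_iff measurableSet_ball).2 (integrableOn_const measure_ball_lt_top.ne)
  have hg : Integrable (fun b : E5 => (1 + ‖b‖) ^ (-r)) :=
    integrable_one_add_norm (by rw [finrank_euclideanSpace_fin]; exact_mod_cast hr)
  have hprod := hf.mul_prod hg
  have h := (measurePreserving_splitMap.integrable_comp_emb splitMap.measurableEmbedding).2 hprod
  refine h.congr (Eventually.of_forall fun z => ?_)
  simp only [comp_apply, splitMap_apply, norm_perpL]

/-! ### The coefficient `Q_g` and the field `H_g` -/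

/-- The argument map `z ↦ ‖proj z - x‖²` is smooth. [folklore] -/
theorem contDiff_normSq_proj_sub (x : E3) {n : WithTop ℕ∞} : ContDiff ℝ n fun z : E8 => ‖proj z - x‖ ^ 2 :=
  (((projL : E8 →L[ℝ] E3).contDiff).sub contDiff_const).norm_sq ℝ

/-- The argument map `z ↦ ‖perp z‖²` is smooth. [folklore] -/
theorem contDiff_normSq_perpL {n : WithTop ℕ∞} : ContDiff ℝ n fun z : E8 => ‖perpL z‖ ^ 2 :=
  (perpL : E8 →L[ℝ] E8).contDiff.norm_sq ℝ

/-- The integrand is smooth on `ℝ × ℝ⁸` for smooth `g`. [folklore] -/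
theorem contDiff_escapeIntegrand (hg : ContDiff ℝ ∞ g) (x : E3) : ContDiff ℝ ∞ (escapeIntegrand g x) := by
  unfold escapeIntegrand
  refine (contDiff_fst.pow 4).mul (hg.comp ?_)
  exact ((contDiff_normSq_proj_sub x).comp contDiff_snd).add
    ((contDiff_normSq_perpL.comp contDiff_snd).mul (contDiff_fst.pow 2))

/-- **`Q_g` is smooth** for smooth `g` (smooth dependence of parametric integrals on parameters). [folklore] -/
theorem contDiff_escapeCoeff (hg : ContDiff ℝ ∞ g) (x : E3) : ContDiff ℝ ∞ (escapeCoeff g x) :=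
  Literature.Analysis.FunctionSpaces.contDiff_parametric_intervalIntegral (contDiff_escapeIntegrand hg x) 0 1

/-- **`H_g` is `C¹`** (indeed smooth) for smooth `g`. [folklore] -/
theorem contDiff_escapeField (hg : ContDiff ℝ ∞ g) (x : E3) : ContDiff ℝ 1 (escapeField g x) :=
  ((contDiff_escapeCoeff hg x).of_le (by exact_mod_cast le_top)).smul (perpL : E8 →L[ℝ] E8).contDiff

/-! ### The derivative of `Q_g` along `perp z` -/

/-- The partial derivative of the integrand in `z`, in the direction `perp z`:
`D_z[w⁴ g(A + T w²)](perp z) = w⁴ g′(A + Tw²) · 2Tw²` (`DA(z)[perp z] = 0`, `DT(z)[perp z] = 2T`). [folklore] -/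
theorem fderiv_escapeIntegrand_snd_perpL (hg : ContDiff ℝ ∞ g) (x : E3) (w : ℝ) (z : E8) :
    fderiv ℝ (fun q : E8 => escapeIntegrand g x (w, q)) z (perpL z) =
      w ^ 4 * deriv g (‖proj z - x‖ ^ 2 + ‖perpL z‖ ^ 2 * w ^ 2) * (2 * ‖perpL z‖ ^ 2 * w ^ 2) := by
  have hA : HasFDerivAt (fun q : E8 => ‖proj q - x‖ ^ 2)
      (2 • (innerSL ℝ (proj z - x)).comp (projL : E8 →L[ℝ] E3)) z := by
    have h := ((projL : E8 →L[ℝ] E3).hasFDerivAt (x := z)).sub_const x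
    exact h.norm_sq
  have hT : HasFDerivAt (fun q : E8 => ‖perpL q‖ ^ 2) (2 • (innerSL ℝ (perpL z)).comp (perpL : E8 →L[ℝ] E8)) z :=
    ((perpL : E8 →L[ℝ] E8).hasFDerivAt (x := z)).norm_sq
  have hin : HasFDerivAt (fun q : E8 => ‖proj q - x‖ ^ 2 + ‖perpL q‖ ^ 2 * w ^ 2)
      (2 • (innerSL ℝ (proj z - x)).comp (projL : E8 →L[ℝ] E3) +
        (w ^ 2) • (2 • (innerSL ℝ (perpL z)).comp (perpL : E8 →L[ℝ] E8))) z := by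
    have h2 := hT.mul_const (w ^ 2)
    refine (hA.add h2).congr_fderiv ?_
    rw [smul_comm]
  set s : ℝ := ‖proj z - x‖ ^ 2 + ‖perpL z‖ ^ 2 * w ^ 2
  have hgd : HasDerivAt g (deriv g s) s := ((hg.differentiable (by simp)).differentiableAt).hasDerivAt
  have hcomp := (hgd.comp_hasFDerivAt z hin).const_mul (w ^ 4)
  rw [show (fun q : E8 => escapeIntegrand g x (w, q)) = fun q => w ^ 4 * (g ∘ fun q : E8 =>
      ‖proj q - x‖ ^ 2 + ‖perpL q‖ ^ 2 * w ^ 2) q from rfl, hcomp.fderiv]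
  simp only [_root_.FunLike.coe_smul, Pi.smul_apply, _root_.add_apply,
    ContinuousLinearMap.coe_comp, comp_apply, projL_apply, proj_perpL, innerSL_apply_apply, inner_zero_right,
    smul_zero, zero_add, perpL_perpL, real_inner_self_eq_norm_sq, smul_eq_mul]
  ring

/-- **The derivative of `Q_g` along `perp z`**: `DQ_g(z)[perp z] = ∫₀¹ w⁴ g′(A + Tw²) 2Tw² dw`. [folklore] -/
theorem fderiv_escapeCoeff_perpL (hg : ContDiff ℝ ∞ g) (x : E3) (z : E8) :
    fderiv ℝ (escapeCoeff g x) z (perpL z) =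
      ∫ w in (0 : ℝ)..1, w ^ 4 * deriv g (‖proj z - x‖ ^ 2 + ‖perpL z‖ ^ 2 * w ^ 2) * (2 * ‖perpL z‖ ^ 2 * w ^ 2) := by
  have h1 : (∞ : WithTop ℕ∞) ≠ 0 := by exact_mod_cast WithTop.coe_ne_zero.2 (by decide)
  have hH := contDiff_escapeIntegrand hg x
  have hfun : escapeCoeff g x = fun z => ∫ w in (0 : ℝ)..1, escapeIntegrand g x (w, z) := rfl
  rw [hfun, Literature.Analysis.FunctionSpaces.fderiv_parametric_intervalIntegral_apply hH h1 0 1 z (perpL z)]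
  refine intervalIntegral.integral_congr fun w _ => ?_
  have h2 := (Literature.Analysis.FunctionSpaces.hasFDerivAt_comp_prodMk hH h1 w z).fderiv
  have h3 : fderiv ℝ (fun q : E8 => escapeIntegrand g x (w, q)) z (perpL z) =
      fderiv ℝ (escapeIntegrand g x) (w, z) ((0 : ℝ), perpL z) := by
    rw [h2, ContinuousLinearMap.comp_apply, ContinuousLinearMap.inr_apply]
  rw [← h3, fderiv_escapeIntegrand_snd_perpL hg x w z]

/-- **Fundamental theorem of calculus for `w ↦ w⁵ g(A + Tw²)` on `[0, 1]`**:
`∫₀¹ (5w⁴ g(A + Tw²) + w⁴ g′(A + Tw²) 2Tw²) dw = g(A + T)`. [folklore] -/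
theorem integral_euler_identity (hg : ContDiff ℝ ∞ g) (A T : ℝ) :
    ∫ w in (0 : ℝ)..1, (5 * (w ^ 4 * g (A + T * w ^ 2)) + w ^ 4 * deriv g (A + T * w ^ 2) * (2 * T * w ^ 2)) =
      g (A + T) := by
  have hgd : ∀ s, HasDerivAt g (deriv g s) s := fun s =>
    ((hg.differentiable (by simp)).differentiableAt).hasDerivAt
  have hderiv : ∀ w : ℝ, HasDerivAt (fun w : ℝ => w ^ 5 * g (A + T * w ^ 2))
      (5 * (w ^ 4 * g (A + T * w ^ 2)) + w ^ 4 * deriv g (A + T * w ^ 2) * (2 * T * w ^ 2)) w := fun w => by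
    have h1 : HasDerivAt (fun w : ℝ => A + T * w ^ 2) (T * (2 * w)) w := by
      simpa using ((hasDerivAt_pow 2 w).const_mul T).const_add A
    have h2 : HasDerivAt (fun w : ℝ => g (A + T * w ^ 2)) (deriv g (A + T * w ^ 2) * (T * (2 * w))) w :=
      (hgd _).comp w h1
    have h3 : HasDerivAt (fun w : ℝ => w ^ 5) (5 * w ^ 4) w := by simpa using hasDerivAt_pow 5 w
    refine (h3.mul h2).congr_deriv ?_
    ring
  have hcont : Continuous fun w : ℝ => 5 * (w ^ 4 * g (A + T * w ^ 2)) +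
      w ^ 4 * deriv g (A + T * w ^ 2) * (2 * T * w ^ 2) := by
    have hgc : Continuous g := hg.continuous
    have hg'c : Continuous (deriv g) := hg.continuous_deriv (by simp)
    fun_prop
  rw [intervalIntegral.integral_eq_sub_of_hasDerivAt (fun w _ => hderiv w) (hcont.intervalIntegrable _ _)]
  simp

/-- **Euler identity**: `5 Q_g(z) + DQ_g(z)[perp z] = g(‖z - ι x‖²)`. [folklore] -/
theorem five_mul_escapeCoeff_add (hg : ContDiff ℝ ∞ g) (x : E3) (z : E8) :
    5 * escapeCoeff g x z + fderiv ℝ (escapeCoeff g x) z (perpL z) = g (‖z - emb x‖ ^ 2) := by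
  have hgc : Continuous g := hg.continuous
  have hg'c : Continuous (deriv g) := hg.continuous_deriv (by simp)
  have hi1 : IntervalIntegrable (fun w : ℝ => 5 * (w ^ 4 * g (‖proj z - x‖ ^ 2 + ‖perpL z‖ ^ 2 * w ^ 2)))
      volume 0 1 := by
    apply Continuous.intervalIntegrable; fun_prop
  have hi2 : IntervalIntegrable (fun w : ℝ => w ^ 4 * deriv g (‖proj z - x‖ ^ 2 + ‖perpL z‖ ^ 2 * w ^ 2) *
      (2 * ‖perpL z‖ ^ 2 * w ^ 2)) volume 0 1 := by
    apply Continuous.intervalIntegrable; fun_prop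
  rw [fderiv_escapeCoeff_perpL hg x z, norm_sub_emb_sq]
  have h1 : escapeCoeff g x z = ∫ w in (0 : ℝ)..1, w ^ 4 * g (‖proj z - x‖ ^ 2 + ‖perpL z‖ ^ 2 * w ^ 2) := rfl
  rw [h1, ← intervalIntegral.integral_const_mul, ← intervalIntegral.integral_add hi1 hi2]
  exact integral_euler_identity hg _ _

/-! ### The divergence of `H_g` and its weak form -/

/-- **`div H_g = g(‖· - ι x‖²)`** pointwise, for smooth `g`. [folklore] -/
theorem divergence_escapeField (hg : ContDiff ℝ ∞ g) (x : E3) (z : E8) :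
    Literature.Analysis.FluidPDE.VectorCalculus.divergence (escapeField g x) z = g (‖z - emb x‖ ^ 2) := by
  have hQ : DifferentiableAt ℝ (escapeCoeff g x) z := ((contDiff_escapeCoeff hg x).differentiable (by simp)) z
  rw [show (escapeField g x) = fun y => escapeCoeff g x y • perpL y from rfl,
    Literature.Analysis.FluidPDE.divergence_smul_apply hQ (perpL : E8 →L[ℝ] E8).differentiableAt,
    divergence_perpL, real_inner_comm, gradient, InnerProductSpace.toDual_symm_apply, ← five_mul_escapeCoeff_add hg x z]
  ring

/-- **Weak form**: `∫ ⟪H_g, ∇φ⟫ = -∫ g(‖z - ι x‖²) φ(z) dz` for every `φ ∈ C¹_c(ℝ⁸)` (Gauss–Green without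
boundary for the `C¹` field `H_g`). [cite: Evans2010, App. C.2 Thm 3] -/
theorem integral_inner_escapeField (hg : ContDiff ℝ ∞ g) (x : E3) {φ : E8 → ℝ} (hφ : ContDiff ℝ 1 φ)
    (hφc : HasCompactSupport φ) :
    ∫ z, ⟪escapeField g x z, gradient φ z⟫ = -∫ z, g (‖z - emb x‖ ^ 2) * φ z := by
  have h := Literature.Analysis.FluidPDE.integral_mul_divergence_add_eq_zero_left hφ (contDiff_escapeField hg x) hφc
  have h1 : ∫ z, φ z * Literature.Analysis.FluidPDE.VectorCalculus.divergence (escapeField g x) z =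
      ∫ z, g (‖z - emb x‖ ^ 2) * φ z :=
    integral_congr_ae (Eventually.of_forall fun z => by simp only; rw [divergence_escapeField hg x z, mul_comm])
  linarith

/-! ### Pointwise bounds (any profile `0 ≤ g ≤ 𝟙_{(-∞, ε²)}`) -/

/-- `0 ≤ Q_g` for `g ≥ 0`. [folklore] -/
theorem escapeCoeff_nonneg (hg0 : ∀ s, 0 ≤ g s) (x : E3) (z : E8) : 0 ≤ escapeCoeff g x z :=
  intervalIntegral.integral_nonneg zero_le_one fun _ hw => mul_nonneg (pow_nonneg hw.1 4) (hg0 _)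

/-- `Q_g ≤ 1/5` for `g ≤ 1` (`∫₀¹ w⁴ dw = 1/5`), indeed `Q_g ≤ 1`. [folklore] -/
theorem escapeCoeff_le (hg1 : ∀ s, g s ≤ 1) (hg0 : ∀ s, 0 ≤ g s) (x : E3) (z : E8) : escapeCoeff g x z ≤ 1 := by
  have h : ∀ w ∈ uIoc (0 : ℝ) 1, ‖escapeIntegrand g x (w, z)‖ ≤ 1 := fun w hw => by
    rw [uIoc_of_le zero_le_one] at hw
    simp only [escapeIntegrand, Real.norm_eq_abs, abs_mul, abs_pow, abs_of_nonneg hw.1.le]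
    rw [abs_of_nonneg (hg0 _)]
    exact mul_le_one₀ (pow_le_one₀ hw.1.le hw.2) (hg0 _) (hg1 _)
  have := intervalIntegral.norm_integral_le_of_norm_le_const h
  rw [sub_zero, abs_one, mul_one, Real.norm_eq_abs] at this
  exact (le_abs_self _).trans this

/-- **Transverse decay**: `Q_g(z) ≤ ε⁴ / ‖perp z‖⁴` when `g ≤ 𝟙_{(-∞, ε²)}`, `g ≥ 0` (on the support of the
integrand `‖perp z‖² w² < ε²`, so `w⁴ < ε⁴/‖perp z‖⁴`). [folklore] -/
theorem escapeCoeff_le_decay (hε : 0 < ε) (hg1 : ∀ s, g s ≤ 1) (hg0 : ∀ s, 0 ≤ g s)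
    (hgε : ∀ s, ε ^ 2 ≤ s → g s = 0) (x : E3) {z : E8} (hz : 0 < ‖perpL z‖) :
    escapeCoeff g x z ≤ ε ^ 4 / ‖perpL z‖ ^ 4 := by
  have h : ∀ w ∈ uIoc (0 : ℝ) 1, ‖escapeIntegrand g x (w, z)‖ ≤ ε ^ 4 / ‖perpL z‖ ^ 4 := fun w hw => by
    rw [uIoc_of_le zero_le_one] at hw
    simp only [escapeIntegrand, Real.norm_eq_abs, abs_mul, abs_pow, abs_of_nonneg hw.1.le]
    rw [abs_of_nonneg (hg0 _)]
    by_cases hs : ε ^ 2 ≤ ‖proj z - x‖ ^ 2 + ‖perpL z‖ ^ 2 * w ^ 2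
    · rw [hgε _ hs, mul_zero]; positivity
    · rw [not_le] at hs
      have h1 : ‖perpL z‖ ^ 2 * w ^ 2 < ε ^ 2 := by nlinarith [sq_nonneg ‖proj z - x‖]
      have h2 : w ^ 2 < ε ^ 2 / ‖perpL z‖ ^ 2 := by
        rw [lt_div_iff₀ (by positivity)]; linarith
      calc w ^ 4 * g _ ≤ w ^ 4 * 1 := mul_le_mul_of_nonneg_left (hg1 _) (by positivity)
        _ = (w ^ 2) ^ 2 := by ring
        _ ≤ (ε ^ 2 / ‖perpL z‖ ^ 2) ^ 2 := pow_le_pow_left₀ (sq_nonneg _) h2.le 2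
        _ = ε ^ 4 / ‖perpL z‖ ^ 4 := by rw [div_pow]; ring
  have := intervalIntegral.norm_integral_le_of_norm_le_const h
  rw [sub_zero, abs_one, mul_one, Real.norm_eq_abs] at this
  exact (le_abs_self _).trans this

/-- **Support**: `Q_g(z) = 0` unless `‖proj z - x‖ < ε` (for `g` vanishing on `[ε², ∞)`). [folklore] -/
theorem escapeCoeff_eq_zero (hgε : ∀ s, ε ^ 2 ≤ s → g s = 0) (hε : 0 ≤ ε) (x : E3) {z : E8}
    (hz : ε ≤ ‖proj z - x‖) : escapeCoeff g x z = 0 := by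
  refine intervalIntegral.integral_zero_ae (Eventually.of_forall fun w _ => ?_)
  simp only [escapeIntegrand]
  rw [hgε _ ?_, mul_zero]
  nlinarith [pow_le_pow_left₀ hε hz 2, sq_nonneg (‖perpL z‖ * w)]

/-- **Confinement**: `H_g(z) ≠ 0 ⟹ proj z ∈ B(x, ε)`. [folklore] -/
theorem proj_mem_ball_of_escapeField_ne_zero (hgε : ∀ s, ε ^ 2 ≤ s → g s = 0) (hε : 0 ≤ ε) (x : E3) {z : E8}
    (hz : escapeField g x z ≠ 0) : proj z ∈ ball x ε := by
  rw [mem_ball, dist_eq_norm]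
  by_contra h
  exact hz (by rw [escapeField, escapeCoeff_eq_zero hgε hε x (not_lt.1 h), zero_smul])

/-- **Weighted bound**: `‖H_g(z)‖ ≤ ε(1 + ε)³ (1 + ‖perp z‖)⁻³` for `0 ≤ g ≤ 𝟙_{(-∞, ε²)}` (near the
axis `‖H‖ ≤ ‖perp z‖ ≤ ε`, far from it `‖H‖ ≤ ε⁴‖perp z‖⁻³`). [folklore] -/
theorem norm_escapeField_le_weight (hε : 0 < ε) (hg1 : ∀ s, g s ≤ 1) (hg0 : ∀ s, 0 ≤ g s)
    (hgε : ∀ s, ε ^ 2 ≤ s → g s = 0) (x : E3) (z : E8) :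
    ‖escapeField g x z‖ ≤ ε * (1 + ε) ^ 3 * (1 + ‖perpL z‖)⁻¹ ^ 3 := by
  have hQ0 := escapeCoeff_nonneg hg0 x z
  rw [escapeField, norm_smul, Real.norm_eq_abs, abs_of_nonneg hQ0]
  set P : ℝ := ‖perpL z‖ with hP
  have hP0 : 0 ≤ P := norm_nonneg _
  rcases le_or_gt P ε with hle | hlt
  · -- near the axis
    have h1 : escapeCoeff g x z * P ≤ ε := by
      calc escapeCoeff g x z * P ≤ 1 * ε := mul_le_mul (escapeCoeff_le hg1 hg0 x z) hle hP0 zero_le_one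
        _ = ε := one_mul ε
    have h2 : (1 : ℝ) ≤ (1 + ε) ^ 3 * (1 + P)⁻¹ ^ 3 := by
      rw [← mul_pow, inv_eq_one_div, mul_one_div]
      exact one_le_pow₀ ((one_le_div (by positivity)).2 (by linarith))
    calc escapeCoeff g x z * P ≤ ε * 1 := by rw [mul_one]; exact h1
      _ ≤ ε * ((1 + ε) ^ 3 * (1 + P)⁻¹ ^ 3) := mul_le_mul_of_nonneg_left h2 hε.le
      _ = ε * (1 + ε) ^ 3 * (1 + P)⁻¹ ^ 3 := by ring
  · -- far from the axis
    have hPpos : 0 < P := hε.trans hlt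
    have h1 : escapeCoeff g x z * P ≤ ε ^ 4 / P ^ 4 * P :=
      mul_le_mul_of_nonneg_right (escapeCoeff_le_decay hε hg1 hg0 hgε x hPpos) hP0
    have h2 : ε ^ 4 / P ^ 4 * P = ε * (ε * P⁻¹) ^ 3 := by field_simp
    have h3 : ε * P⁻¹ ≤ (1 + ε) * (1 + P)⁻¹ := by
      rw [inv_eq_one_div, inv_eq_one_div, mul_one_div, mul_one_div, div_le_div_iff₀ hPpos (by positivity)]
      nlinarith
    calc escapeCoeff g x z * P ≤ ε * (ε * P⁻¹) ^ 3 := h1.trans_eq h2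
      _ ≤ ε * ((1 + ε) * (1 + P)⁻¹) ^ 3 := mul_le_mul_of_nonneg_left (pow_le_pow_left₀ (by positivity) h3 3) hε.le
      _ = ε * (1 + ε) ^ 3 * (1 + P)⁻¹ ^ 3 := by ring

/-- The crude local bound `‖H_g(z)‖ ≤ ‖z‖` (`Q_g ≤ 1`, `‖perp z‖ ≤ ‖z‖`), any `0 ≤ g ≤ 1`. [folklore] -/
theorem norm_escapeField_le_norm (hg1 : ∀ s, g s ≤ 1) (hg0 : ∀ s, 0 ≤ g s) (x : E3) (z : E8) :
    ‖escapeField g x z‖ ≤ ‖z‖ := by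
  rw [escapeField, norm_smul, Real.norm_eq_abs, abs_of_nonneg (escapeCoeff_nonneg hg0 x z)]
  calc escapeCoeff g x z * ‖perpL z‖ ≤ 1 * ‖z‖ :=
      mul_le_mul (escapeCoeff_le hg1 hg0 x z) (norm_perpL_le z) (norm_nonneg _) zero_le_one
    _ = ‖z‖ := one_mul _

/-- **Registered sub-goal `divergence_perpL_five`** (line `flux-cell-joint-census`, support of
`stub_confinedThomson`): the transverse trace `div perp = 5`, binder form of `divergence_perpL`. [folklore] -/
theorem divergence_perpL_five : ∀ z : E8, Literature.Analysis.FluidPDE.VectorCalculus.divergence perpL z = 5 :=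
  fun z => divergence_perpL z

end Summit.AtomisticToContinuum.Crystallization.Theorems.PricedLinkCensusLocalToGlobal

end
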